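import Summits.QuantumFields.BalabanUV.T4Continuum.Support.DirichletScalarTowerLevels
import Summits.QuantumFields.BalabanUV.T4Continuum.Support.DirichletMonotoneTwoLevel

/-!
# `BalabanUV.T4Continuum.Support.DirichletScalarTowerMonotone` — NE2 (node U1a) formalisation swarm, SUPPLIER item «Δ1-BESOV» under the
# owner's sub-row `T4-U1a.S-NE2-D1-DIRICHLET°`: THE Ω-RESTRICTED SCALAR FREE TOWER ON A LOCALLY MONOTONE UNION OF UNIT BLOCKS IS
# UNCONDITIONAL — the Besov two-level law (`DirichletMonotoneTwoLevel.injected_le_of_locallyMonotone`) DISCHARGES the owner's injected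
# binder `hinjS` (`Support/DirichletScalarTower`) at the geometric rate `(√L)⁻¹`, so [B9] (3.24)'s `G′ = (Ω₀Δ′_aΩ₀)⁻¹` at `U = 1` obeys ALL
# the `FreeTowerLaws` and its unit-lattice images CONVERGE at rate `(√L)⁻¹` on every LOCALLY MONOTONE region — boxes AND re-entrant
# configurations (L-shapes, complements of boxes, Fichera corners …), NO displayed binder (unit b2b-balaban-t4-ne2-formalise-leaf-08, gen 3, v1)

HONEST FRAMING.  Rung (B)+1 bookkeeping at MODEL level (U = 1 scalar layer), finite torus; NE2 (U1a) is NOT proved by this file; spine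
PROVED 0/9 unchanged; NOT infinite volume, NOT the mass gap, NOT Clay.  HONEST DEPENDENCY (verbatim): «continuum YM on T⁴ ⇐ BetaPertH ∧
nine spine estimates (0/9 proved); BetaPertH ⇐ (D1) ∧ (D4) ∧ CAP+tail; G-an2-4 gates asym, D1 and NE2/3/4.»

This is the MONOTONE TWIN of the owner's `Support/DirichletScalarTowerBox` (t4-ne2-p1 gen 12, O12-d: boxes, torus rate `L⁻¹`, via road
P2's `DirichletBoxTwoLevel.injected_le_box`), plugged through the owner's LEVEL ADAPTER `Support/DirichletScalarTowerLevels` (O12-e, ruling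
R22 (b)(ii): `injected_regS_le_of_blockReg`, `towerLimitRate_dirichletScalar_of_sqrt_levels` — «the consumer of the Δ1-BESOV END, by
`exact`»; `sqrt_lev`, `invL_le_inv_sqrt`, `inv_sqrt_lt_one`) BY NAME — nothing of the owner's or of road P2's restated:
 * §1 `injected_le_monotone_levels` (module (III)'s END at `(n_k, L)` in road P2's spelling) and **`injected_le_monotone_lev (hS : LocallyMonotone M S) (hL : 2 ≤ L) (ha′) (k)`**:
   `‖(DsR (k+1))⁻¹·JsR k − JsR k·(DsR k)⁻¹‖ ≤ besovConst d a′ 6 48 · √L · ((√L)⁻¹)^k` for `Ω₀ = blockReg (lev L 0) M S` — `hinjS` IS A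
   THEOREM on every locally monotone union of unit blocks, at the rate `(√L)⁻¹ ∈ [L⁻¹, 1)`;
 * §2 **`freeTowerLaws_dirichletScalar_monotone (hL : 2 ≤ L) (hd : 0 < d) (ha′ : 0 < a′) (hS : LocallyMonotone M S)`** — every field of
   `FreeTowerLaws` for the Ω-restricted scalar tower, displayed binders `2 ≤ L`, `0 < d`, `0 < a′`, `LocallyMonotone M S` and NOTHING ELSE;
   **`towerLimitRate_dirichletScalar_monotone … : TowerLimitRate (QsR …) L^d (k ↦ (DsR … k)⁻¹) (Cpert 0 (2d√(γ′⁻¹)) (besovConst·√L) 0 0 0) (√L)⁻¹`**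
   — the Ω-restricted unit-lattice scalar free covariances CONVERGE as `η = L^{−k} → 0` at the rate `(√L)⁻¹`, UNCONDITIONALLY, on every
   locally monotone region, every `d ≥ 1`, `a′ > 0`, `L ≥ 2` (the owner's `towerLimitRate_dirichletScalar_of_injected` at `θ = (√L)⁻¹`);
   `…_monotone_perturbed`: the resolvent route over such a region (only the perturbation family's `PerturbationLaws` displayed);
 * §3 `…_box'`: the box case re-derived through `locallyMonotone_of_isCoordBox` (consistency with O12-d at the weaker rate).

ABSOLUTE RULE (cell, verbatim): «No internally-minted statement may enter as a cited fact. Every hypothesis is either kernel-proved in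
this package or a verbatim quotation of a PUBLISHED theorem with page reference. The manuscript(s) under audit are NOT citable for
their own disputed steps — they are the thing under adjudication; programme-internal (2001/route/tribunal) claims are never citable.»
[folklore] composition BY NAME; no `def … : Prop` fact.  NOT CLAIMED: the torus rate `L⁻¹` on non-convex regions (leaf-07-g4's numerics
`t4/T4-EST-NE2-D1-INJ.md` measure it; the Besov method gives `(√L)⁻¹`); non-monotone unions of blocks; the VECTOR layer ∕ printed gauge
term (G-ne2p1-g12-1); NOT [B9] (3.23)–(3.27) as printed; NE2; NE3; «not in print; our proof».
-/

noncomputable section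

open scoped BigOperators ComplexConjugate Matrix Matrix.Norms.L2Operator
open Filter Topology

namespace Summit.QuantumFields.BalabanUV.T4Continuum.DirichletScalarTowerMonotone

open Literature.MathematicalPhysics.QuantumFieldTheory.Balaban1983to89.B5Prop11Plancherel (Tor fine)
open Literature.MathematicalPhysics.QuantumFieldTheory.Balaban1983to89.B5G183RateUnitTower (lev lev_neZero)
open Summit.QuantumFields.BalabanUV.T4Continuum
open Summit.QuantumFields.BalabanUV.T4Continuum.CovariantAveragingTower (TowerLimitRate)
open Summit.QuantumFields.BalabanUV.T4Continuum.BalabanAveragedTowerUnit (one_le_lev' cast_lev')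
open Summit.QuantumFields.BalabanUV.T4Continuum.BackgroundResolventTower
open Summit.QuantumFields.BalabanUV.T4Continuum.ScalarAveragedPropagator (gammaPs)
open Summit.QuantumFields.BalabanUV.T4Continuum.DirichletScalarTower
open Summit.QuantumFields.BalabanUV.T4Continuum.DirichletScalarTowerLevels (injected_regS_le_of_blockReg
  towerLimitRate_dirichletScalar_of_sqrt_levels sqrt_lev invL_le_inv_sqrt inv_sqrt_lt_one)
open Summit.QuantumFields.BalabanUV.Beta.GAN24.DirichletBoxCompression (DOm JOm refineR)
open Summit.QuantumFields.BalabanUV.T4Continuum.DirichletBesovTwoLevel (besovConst besovConst_nonneg)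
open Summit.QuantumFields.BalabanUV.T4Continuum.DirichletMonotoneCutoff (LocallyMonotone)
open Summit.QuantumFields.BalabanUV.T4Continuum.DirichletMonotoneTwoLevel (injected_le_of_locallyMonotone
  locallyMonotone_of_isCoordBox)
open Summit.QuantumFields.BalabanUV.Beta.GAN24.DirichletBoxTrace (blockReg)
open Summit.QuantumFields.BalabanUV.Beta.GAN24.DirichletBoxTwoLevel (IsCoordBox)

variable {d : ℕ} (L : ℕ) [NeZero L] (M : Fin d → ℕ) [hM : ∀ μ, NeZero (M μ)] (a' : ℝ) (S : Tor M → Prop) [DecidablePred S]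

/-! ## §1 `hinjS` is a theorem on locally monotone unions of unit blocks -/

omit hM [DecidablePred S] in
/-- `2 ≤ L ≤ L·n_k`. [folklore] -/
theorem two_le_mul_lev (hL : 2 ≤ L) (k : ℕ) : 2 ≤ L * lev L k :=
  hL.trans (Nat.le_mul_of_pos_right L (one_le_lev' L k))

/-- module (III)'s END at every level `(N, R) = (n_k, L)`, in road P2's spelling (the shape the owner's adapter consumes). [folklore] -/
theorem injected_le_monotone_levels (hS : LocallyMonotone M S) (hL : 2 ≤ L) (ha' : 0 < a') (k : ℕ) :
    ‖(DOm (L * lev L k) M a' (refineR (lev L k) L M (blockReg (lev L k) M S)))⁻¹ * JOm (lev L k) L M (blockReg (lev L k) M S)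
        - JOm (lev L k) L M (blockReg (lev L k) M S) * (DOm (lev L k) M a' (blockReg (lev L k) M S))⁻¹‖
      ≤ besovConst d a' 6 48 * Real.sqrt (L : ℝ) / Real.sqrt ((lev L k : ℕ) : ℝ) :=
  injected_le_of_locallyMonotone (lev L k) L M S hS (one_le_lev' L k) (two_le_mul_lev L hL k) ha'

/-- **THE INJECTED LAW `hinjS` IS A THEOREM ON EVERY LOCALLY MONOTONE UNION OF UNIT BLOCKS**, at the geometric rate `(√L)⁻¹`:
`‖(DsR (k+1))⁻¹·JsR k − JsR k·(DsR k)⁻¹‖ ≤ besovConst d a′ 6 48 · √L · ((√L)⁻¹)^k` for the tower generated by `Ω₀ = blockReg (lev L 0) M S`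
(the owner's adapter `injected_regS_le_of_blockReg` + `sqrt_lev`). [folklore] -/
theorem injected_le_monotone_lev (hS : LocallyMonotone M S) (hL : 2 ≤ L) (ha' : 0 < a') (k : ℕ) :
    ‖(DsR L M a' (blockReg (lev L 0) M S) (k + 1))⁻¹ * JsR L M (blockReg (lev L 0) M S) k
        - JsR L M (blockReg (lev L 0) M S) k * (DsR L M a' (blockReg (lev L 0) M S) k)⁻¹‖
      ≤ besovConst d a' 6 48 * Real.sqrt (L : ℝ) * (Real.sqrt (L : ℝ))⁻¹ ^ k := by
  have h := injected_regS_le_of_blockReg L M a' S (injected_le_monotone_levels L M a' S hS hL ha') k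
  rw [sqrt_lev, div_eq_mul_inv, ← inv_pow] at h
  exact h

/-! ## §2 The ENDs: the scalar Dirichlet free tower of a locally monotone region, no displayed binder -/

/-- **THE Ω-RESTRICTED SCALAR FREE TOWER LAWS ON A LOCALLY MONOTONE UNION OF UNIT BLOCKS — UNCONDITIONAL** (`U = 1`, `L ≥ 2`,
`d ≥ 1`, `a′ > 0`, `S` locally monotone): every field of `FreeTowerLaws` for [B9] (3.24)'s `Ω₀Δ′_aΩ₀` at `U = 1` along `n_k = L^k` is a
THEOREM — invertibility, `‖QsR‖² ≤ L^{−d}`, `‖JsR‖ ≤ 1`, exact pairing, complement law `2d√(γ′⁻¹)·L^{−k}` (the owner's), AND the injected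
law `besovConst·√L·(√L)^{−k}` (this route).  Displayed binders: `2 ≤ L`, `0 < d`, `0 < a′`, `LocallyMonotone M S` — nothing else.
[cite: Balaban1985BackgroundPropagators, p.394 (3.24), Thm 3.1 (3.42) p.397 (η-uniform kind only; the rate is ours)] [folklore] -/
theorem freeTowerLaws_dirichletScalar_monotone (hL : 2 ≤ L) (hd : 0 < d) (ha' : 0 < a') (hS : LocallyMonotone M S) :
    FreeTowerLaws (DsR L M a' (blockReg (lev L 0) M S)) (QsR L M (blockReg (lev L 0) M S)) (JsR L M (blockReg (lev L 0) M S))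
      (fun _ => 0) ((L : ℝ) ^ d) (fun k => 2 * d * Real.sqrt ((gammaPs d a')⁻¹) * ((L : ℝ)⁻¹) ^ k)
      (fun k => besovConst d a' 6 48 * Real.sqrt (L : ℝ) * (Real.sqrt (L : ℝ))⁻¹ ^ k) (fun _ => 0) :=
  freeTowerLaws_dirichletScalar_of_injected L M a' (blockReg (lev L 0) M S) hd ha' (injected_le_monotone_lev L M a' S hS hL ha')

/-- **THE Ω-RESTRICTED UNIT-LATTICE SCALAR FREE COVARIANCES OF A LOCALLY MONOTONE REGION CONVERGE AT THE RATE `(√L)⁻¹`** (`L ≥ 2`,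
`d ≥ 1`, `a′ > 0`): `TowerLimitRate (QsR (blockReg n₀ S)) L^d (k ↦ (DsR k)⁻¹) (Cpert 0 (2d√(γ′⁻¹)) (besovConst·√L) 0 0 0) (√L)⁻¹` —
UNCONDITIONAL, on boxes AND on re-entrant configurations (L-shapes, complements of boxes, Fichera corners …): King's scalar η-rate
(Lemma 4.5 shape) survives the Dirichlet restriction at a geometric rate with NO convexity — ONE `exact` into the owner's
`towerLimitRate_dirichletScalar_of_sqrt_levels`. [cite: King1986, Lemma 4.5 (4.38) p.674 (shape); Balaban1985BackgroundPropagators,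
p.394 (3.24)] [folklore] -/
theorem towerLimitRate_dirichletScalar_monotone (hL : 2 ≤ L) (hd : 0 < d) (ha' : 0 < a') (hS : LocallyMonotone M S) :
    TowerLimitRate (QsR L M (blockReg (lev L 0) M S)) ((L : ℝ) ^ d) (fun k => (DsR L M a' (blockReg (lev L 0) M S) k)⁻¹)
      (Cpert 0 (2 * d * Real.sqrt ((gammaPs d a')⁻¹)) (besovConst d a' 6 48 * Real.sqrt (L : ℝ)) 0 0 0) ((Real.sqrt (L : ℝ))⁻¹) :=
  towerLimitRate_dirichletScalar_of_sqrt_levels L M a' S hL hd ha' (injected_le_monotone_levels L M a' S hS hL ha')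

/-- **THE RESOLVENT ROUTE OVER A LOCALLY MONOTONE REGION**: for every compressed perturbation family `P` with
`PerturbationLaws (DsR …) P (JsR …) κ (k ↦ C₂(√L)^{−k})` and every `‖t‖κ < 1`, the Ω-restricted perturbed scalar covariances converge at
the rate `(√L)⁻¹` — only the perturbation laws are displayed. [folklore] -/
theorem towerLimitRate_dirichletScalar_monotone_perturbed (hL : 2 ≤ L) (hd : 0 < d) (ha' : 0 < a') (hS : LocallyMonotone M S)
    {P : (k : ℕ) → Matrix (sidx L M (blockReg (lev L 0) M S) k) (sidx L M (blockReg (lev L 0) M S) k) ℂ} {κ C₂ : ℝ}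
    (hpert : PerturbationLaws (DsR L M a' (blockReg (lev L 0) M S)) P (JsR L M (blockReg (lev L 0) M S)) κ
      (fun k => C₂ * ((Real.sqrt (L : ℝ))⁻¹) ^ k)) {t : ℂ} (ht : ‖t‖ * κ < 1) :
    TowerLimitRate (QsR L M (blockReg (lev L 0) M S)) ((L : ℝ) ^ d) (fun k => (DsR L M a' (blockReg (lev L 0) M S) k + t • P k)⁻¹)
      (Cpert κ (2 * d * Real.sqrt ((gammaPs d a')⁻¹)) (besovConst d a' 6 48 * Real.sqrt (L : ℝ)) C₂ 0 t) ((Real.sqrt (L : ℝ))⁻¹) :=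
  towerLimitRate_dirichletScalar_perturbed L M a' (blockReg (lev L 0) M S) hd ha' (invL_le_inv_sqrt L (le_trans one_le_two hL))
    (inv_sqrt_lt_one L hL) (injected_le_monotone_lev L M a' S hS hL ha') hpert ht

/-! ## §3 Consistency face: boxes through local monotonicity -/

/-- the box case re-derived through `locallyMonotone_of_isCoordBox` (weaker rate than the owner's `towerLimitRate_dirichletScalar_box`,
which has `L⁻¹`; recorded as the consistency face of the Besov route). [folklore] -/
theorem towerLimitRate_dirichletScalar_box' (hL : 2 ≤ L) (hd : 0 < d) (ha' : 0 < a') (hS : IsCoordBox M S) :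
    TowerLimitRate (QsR L M (blockReg (lev L 0) M S)) ((L : ℝ) ^ d) (fun k => (DsR L M a' (blockReg (lev L 0) M S) k)⁻¹)
      (Cpert 0 (2 * d * Real.sqrt ((gammaPs d a')⁻¹)) (besovConst d a' 6 48 * Real.sqrt (L : ℝ)) 0 0 0) ((Real.sqrt (L : ℝ))⁻¹) :=
  towerLimitRate_dirichletScalar_monotone L M a' S hL hd ha' (locallyMonotone_of_isCoordBox M hS)

end Summit.QuantumFields.BalabanUV.T4Continuum.DirichletScalarTowerMonotone

end
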